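import Mathlib
import HarnessLib
import HarnessLib.Audit
import Summits.NavierStokesRegularity.Statement
import Literature.Analysis.FluidPDE.ClassicalSolution
import Literature.Analysis.FluidPDE.LerayHopf
import Literature.Analysis.FluidPDE.AxisymmetricEuler
import Literature.Analysis.FluidPDE.NSWave0
import Summits.NavierStokesRegularity.NavierStokesRegularity.Theorems.AdiabaticEddyClayUniqueness
import Summits.NavierStokesRegularity.NavierStokesRegularity.Theorems.SwirlThresholdAssembly
import HarnessLib.Audit.Status.Attr

/-!
Route: DimensionLadder

DORMANT since 2026-08-29T19:37:35Z (census g0: costume|duplicate of route-NavierStokesRegularity-CertifiedBlowup; reader census-reader-51-g0) — unstaffed, not closed; items shared with open routes are served there. `ledger route dormant <id> --off` reactivates.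

Route DimensionLadder — NavierStokesRegularity, NEGATIVE side (target ¬A). Card realised:
NavierStokesRegularity/NavierStokesRegularity/dimension-ladder-blowup (continuation in the space
dimension).

THESIS X ("it suffices to show"): X := X5a_axi ∧ X5b.
In words: (X5a_axi) for some ν > 0 there is a finite-energy (Leray–Hopf) classical solution of
unforced NS on ℝ³ × [0,T), T < ∞, from a rapidly decaying smooth AXISYMMETRIC datum, admitting no
classical extension past T; and (X5b) Clay-class uniqueness: a solution smooth on ℝ³ × [0,∞) with
bounded energy agrees on [0,T) with the finite-energy classical solution from the same datum.
X5a_axi is shared with route CertifiedBlowup (stmt-NavierStokesRegularity-0727), X5b with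
Blowup/CertifiedBlowup (stmt-…-0153); X itself is stmt-…-0725.
Lean (elaborates, Sketch.lean rc 0; decl Target):
(∃ ν : ℝ, 0 < ν ∧ ∃ T : ℝ, 0 < T ∧ ∃ (u : ℝ → EuclideanSpace ℝ (Fin 3) → EuclideanSpace ℝ (Fin 3))
(p : ℝ → EuclideanSpace ℝ (Fin 3) → ℝ), Literature.Analysis.FluidPDE.IsMaximalSmoothSolution ν 0 u p
T ∧ Literature.Analysis.FluidPDE.IsLerayHopfOn T ν 0 (u 0) u ∧
Literature.Analysis.FluidPDE.HasRapidSpatialDecay (u 0) ∧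
Literature.Analysis.FluidPDE.IsAxisymmetric (u 0)) ∧ (X5b verbatim, signature of
stmt-NavierStokesRegularity-0153)

HOW X IS TO BE REACHED (the line): X5a_axi is the n = 3 endpoint of a ONE-PARAMETER FAMILY OF
BLOW-UP PROBLEMS INDEXED BY THE SPACE DIMENSION — Hou's constant-viscosity generalized n-dimensional
axisymmetric Navier–Stokes system (arXiv:2405.10916 §1 eqs (1.1)–(1.3): unknowns (Γ, ω₁, ψ₁)(t,r,z),
u^r = −rψ₁,z, u^z = (n−1)ψ₁ + rψ₁,r), n ≥ 3 REAL. Structural remark of this route (planner's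
derivation, NOTES F1; to be re-proved in Lean as support HopfSwirlDictionary): for ODD n = 2m+1
Hou's system is not a model but EXACTLY incompressible NS on ℝ^{2m+1} = ℂ^m × ℝ restricted to
U(m)-equivariant fields u = u^r ζ/|ζ| + (Γ/|ζ|²)·Jζ + u^z e_z (swirl along the Hopf field Jζ;
SO(d−1)-axisymmetry would force zero swirl in d ≥ 4). So the ladder has genuine Navier–Stokes rungs
at n = 5, 7, 9, … and Hou's non-integer n interpolate between real NS blow-up problems.
LAYER 1 (cruxes, ranked): #2 HighDimBlowup (typed over the generic in-tree predicates: NS blows up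
in SOME dimension d ≥ 4 from a smooth rapidly decaying datum, finite-energy classical solution with
finite maximal time — the first rung and the landmark the whole line stands or falls with); #3
LadderNoFold (informal until Literature.Analysis.FluidPDE.GeneralizedAxisymNS is defined: blow-up
for EVERY real n ≥ 3 — the branch continues without fold down to 3; its n = 3 instance is X5a_axi,
its n = 5 instance gives HighDimBlowup); #4 AxisymBlowup (= X5a_axi, shared endpoint).
LAYER 2 (later, by glued splits once a crux closes): LadderNoFold ⇐ TopRung (∃ n₀, blow-up for all n
≥ n₀) ∧ Descent (the nearly-self-similar profile branch of the dynamic-rescaling equations with n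
frozen continues on [3, n₀] with spectral gap bounded below) ∧ (profile + gap ⇒ blow-up at that n);
HopfSwirlDictionary (odd n ↔ U(m)-equivariant NS; m = 1 gives AxisymBlowup from the n = 3 rung).
ASSEMBLY: AxisymBlowup → ClayUniqueness → ¬NavierStokesRegularity (curried form of
Literature.NS.certifiedBlowup_assembly_v2, already proved; Sketch.lean checks it).

Rationale: WHY THIS LINE. Every obstruction that is marginal at d = 3 is a closeness-to-criticality effect: the
energy sits (d−2)/2 derivatives below scaling (in-tree
Literature.Barriers.NavierStokesRegularity.energyExponent), partial regularity stops at d = 4, and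
the finite-energy self-similar exponent window (2/(d+2), 1/2) below the viscous threshold widens
with d. Hou (arXiv:2405.10916 = doi:10.1007/s10208-026-09748-8, §1, §2.2) wrote 3-D axisymmetric NS
with the dimension n as a REAL parameter and found a nearly self-similar blow-up whose self-selected
dimension is n = 3.188 (constant ν₀ only in rescaled variables); Miller (arXiv:2508.03877 Thm 1.1,
p.4) and Miller–Tsai (arXiv:2204.13406 = doi:10.4171/rmi/1616) push swirl-free Euler to d → ∞
(Burgers blow-up of the limit; ε = 1/(d−2) perturbation proposed). The card's bet: prove blow-up
HIGH on the dimension ladder and continue the profile branch down to n = 3, reading off X5a_axi or a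
fold point n* > 3. What this route adds (planner's derivation, NOTES F1): Hou's "modified model" at
odd n = 2m+1 IS incompressible NS on ℝ^{2m+1} = ℂ^m × ℝ for U(m)-equivariant fields with swirl along
the Hopf field Jζ, so the integer rungs are genuine NS blow-up problems with swirl and the first
rung is typable today over the tree's dimension-generic predicates (IsMaximalSmoothSolution,
IsLerayHopfOn, HasRapidSpatialDecay hold for any finite-dimensional inner-product space). Imported
areas: equivariant symmetry reduction (cohomogeneity-two U(m) reduction), numerical
continuation/bifurcation (fold point, spectral gap), singular-limit asymptotics (d → ∞); no
probabilistic or spectral reformulation — none bears on a construction.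
RANKED CRUXES. #2 HighDimBlowup (typed) — NS blows up in SOME dimension d ≥ 4 from a smooth rapidly
decaying datum (finite-energy classical solution, finite maximal time); why it might fail: NS may be
regular in every d — no smooth-data mechanism in print; swirl-free axisymmetric smooth data are
globally regular for Euler in 3 ≤ d ≤ 6 (Shao–Wei–Zhang 2026, doi:10.1007/s10114-026-5110-0 — per
the published abstract: hypotheses ω₀/r^{d−2} ∈ L^{d/(d−2),∞}, min{1,r^{3−d}}ω₀/r^α ∈ L^∞, met by
smooth compactly supported data by the planner's check; full text requested, acq-02069) and
numerically at every d (Hou–Zhang: blow-up only for C^α vorticity, α < 1 − 2/d, reported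
arXiv:2508.03877 p.4), so a witness must carry swirl (odd d, U(m)) or break axisymmetry. #3
LadderNoFold (informal, filed after open; needs definition GeneralizedAxisymNS) — blow-up for Hou's
constant-ν family at EVERY real n ≥ 3 (n = 3 instance = X5a_axi, n = 5 instance ⇒ HighDimBlowup);
why it might fail: fold at n* > 3 — no constant-ν profile known at any n (Hou §1.1/§4 needs
solution-dependent ν); the extra vorticity term is +(n−3)(u^r/r)ω₁, DAMPING in Hou's inflow
geometry; and at the diffusive radial scale r ~ √(nν) the formal n → ∞ limit is forced VISCOUS
BURGERS with passive swirl (NOTES F3) — regular — so d = ∞ is not a solvable blow-up member at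
constant viscosity and high rungs need Reynolds number growing with n. #4 AxisymBlowup = X5a_axi
(shared stmt-0727) — why it might fail: AxisymmetricSwirlRegularity (open wall) with X5b refutes it
(certifiedBlowup_kill_edge); Type II rate forced (knss_no_axisymmetric_typeI).
KILL CRITERIA. (K1) Global regularity of smooth finite-energy U(m)-equivariant NS on ℝ^{2m+1} for
all m ≥ 2 (or of smooth NS in all d ≥ 4) kills HighDimBlowup's intended class → close exhausted
unless a non-symmetric high-d mechanism appears. (K2) The cheapest falsifier below comes back empty
at every frozen n ≥ 4 → dormant. (K3) AxisymmetricSwirlRegularity proved → AxisymBlowup refuted →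
route refuted (shared with CertifiedBlowup); a fold n* > 3 found by continuation → close with the
quantitative negative result (which eigenvalue vanishes, at what n*) handed to the positive routes.
(K4) NoBlowup (stmt-0054) proved kills every negative route.
NOT DECOMPOSED YET. The dynamic-rescaling profile equations and their linearisation (objects of
TopRung/Descent); localisation from Hou's periodic cylinder to rapidly decaying data on ℝ^n
(CertifiedBlowup #5 analogue); all numerics (continuation in n, eigenvalue tracking — kit compute in
tenure); the NS version of Shao–Wei–Zhang for 4 ≤ d ≤ 6 (foreseeable support pruning swirl-free
rungs); even n (no Hopf field: model rungs only).
CHEAPEST FALSIFIER. Freeze n ∈ {4, 5, 6, 8} in Hou's published set-up (arXiv:2405.10916 §2.1–§4: his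
initial data and two-scale dynamic rescaling with n held constant) with ONE constant viscosity and
test for sustained nearly-self-similar growth (kit compute, about a week): no rung at any frozen n ≥
4 ⇒ the ladder has no top ⇒ dormant. Already run on paper while grounding: the swirl-free rung is
dead for d ≤ 6 (Shao–Wei–Zhang) — hence swirl on every rung.
TWO-LAYER PLAN. LadderNoFold ⇐ TopRung (∃ n₀, blow-up ∀ n ≥ n₀) → Descent (profile branch continues
on [3, n₀] with spectral gap ≥ δ) → (profile + gap ⇒ blow-up at that n), k = 3; HopfSwirlDictionary
(odd n ↔ U(m)-equivariant NS; m = 1 case = the n = 3 glue LadderNoFold(3) → AxisymBlowup).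
DEFINITION REQUESTS. Literature.Analysis.FluidPDE.GeneralizedAxisymNS (Hou arXiv:2405.10916 eqs
(1.1)–(1.3): smooth even-in-r solutions (Γ, ω₁, ψ₁)(t,r,z), real n ≥ 2, constant ν, u^r = −rψ₁,z,
u^z = (n−1)ψ₁ + rψ₁,r; weighted energy ∫|u|² r^{n−2} dr dz; maximal-solution notion) — filed with
--for LadderNoFold.
SUPPORT. ClayUniqueness = X5b (shared stmt-0153); Target = X5a_axi ∧ X5b (= stmt-0725); Assembly
X5a_axi → X5b → ¬NavierStokesRegularity (curried Literature.NS.certifiedBlowup_assembly_v2, proved;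
Sketch.lean rc 0).

Novelty: NOVELTY (searched 2026-08-15 before claiming: `lit search --source crossref "Navier-Stokes
axisymmetric four dimensions swirl global regularity"` (21 rows: Miller–Tsai doi:10.4171/rmi/1616,
Shao–Wei–Zhang doi:10.1007/s10114-026-5110-0, 3-D criteria only — nothing on swirl in d ≥ 4); `lit
search --source zbmath "axisymmetric Navier-Stokes higher dimensions"` (8 rows, none relevant); `lit
galaxy search --star all` with "axisymmetric Navier-Stokes equations with swirl in higher
dimensions", "bi-rotational symmetry Euler equations four dimensions swirl", "axisymmetric flows in
higher dimensions", "Navier-Stokes equations in high dimensions", "swirl in higher dimensions",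
"infinite dimensional limit of the Euler" (0 relevant hits); `lit search --hybrid --source local`
(books only, nothing); `lit frontier NavierStokesRegularity --since 2022` (Hou FoCM 2026 the only
dimension-varying descendant); `lit read` of arXiv:2405.10916 pp.3,7,8,10,11, arXiv:2508.03877
pp.4-5, arXiv:2204.13406 pp.3-4; DOI landing page of 10.1007/s10114-026-5110-0 (paywalled,
acq-02069). OpenAlex/S2/arXiv APIs were rate-limited during the session (recorded in NOTES).)
Nearest prior art: (a) Hou, arXiv:2405.10916 = doi:10.1007/s10208-026-09748-8, §1 and §2.2 — the
real-n generalized axisymmetric NS family, presented as a MODIFIED model for n ≠ 3 (his single-angle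
swirl ansatz has divergence defect (n−3)cot θ₁ u^θ/r, p.7, so he "modifies the velocity field" and
"treats Γ as density"), dimension self-selected by  [refs: 10.4171/rmi/1616, 10.1007/s10114-026-5110-0, 10.1007/s10208-026-09748-8, 2405.10916, 2508.03877, 2204.13406, doi:10.4171/rmi/1616, doi:10.1007/s10114-026-5110-0, doi:10.1007/s10208-026-09748-8]

Barriers (technique_class: blowup-construction continuation-in-dimension): - technique_class: blowup-construction continuation-in-dimension
- Literature.Barriers.NavierStokesRegularity.AxisymmetricTypeIExclusion: APPLIES at the n = 3
endpoint (AxisymBlowup = X5a_axi): an axisymmetric witness must blow up at a Type II rate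
(SereginSverak2009 Thm 3.1; in-tree Literature.Analysis.FluidPDE.knss_no_axisymmetric_typeI). Not
evaded — respected as a design constraint on every rung: the Γ = r u^θ maximum principle and the
KNSS Liouville mechanism are dimension-robust (Hou arXiv:2405.10916 p.3: "all the known non-blowup
criteria also apply … for a given constant dimension n"), so the continued profile must be NEARLY
self-similar with Type-II-compatible exponents (Hou's c_l = 0.5233 ≠ 1/2) and the continuation must
track the rate exponent and stay off c_l = 1/2 at n = 3.
- Literature.Barriers.NavierStokesRegularity.LeraySelfSimilarBlowupExclusion: APPLIES to exact
backward self-similar profiles (necas_ruzicka_sverak, tsai_selfsimilar,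
tsai_selfsimilar_local_energy); the NRŠ head-pressure maximum-principle argument works in L^n for
every n, so no rung may be an exact Leray profile. Evasion = the entry's own evasions_known: nearly
self-similar (drifting exponents) or DSS profiles; recorded as a constraint on LadderNoFold/TopRung,
not a claim of immunity.
- Literature.Barriers.NavierStokesRegularity.CriticalNormBlowupNecessity: CONSISTENT — any witness
has ‖u(t)‖_{L³} → ∞ (ess_endpoint, seregin_L3_blowup, tao_L3_blowup_rate); at rung n the critical
norm is L^n an

History (route lifecycle, newest last):
- 2026-08-25T05:31:48Z · DORMANT — reconciler: no traction for 7.4 d (last activity item-evidence-added at 2026-08-17T19:02:18Z); parked, not closed — `ledger route dormant route-NavierStokesRegu (operator:999:2225715)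
- 2026-08-27T03:02:26Z · REACTIVATED — reconciler: reactivated — activity item-evidence-added at 2026-08-27T01:17:15Z after parking at 2026-08-25T05:31:48Z (operator:999:2166192)
- 2026-08-29T19:37:35Z · DORMANT — census g0: costume|duplicate of route-NavierStokesRegularity-CertifiedBlowup; reader census-reader-51-g0 (operator:999:1449413)

sub-problem: NavierStokesRegularity · status: dormant · opened planner-plancard-NavierStokesRegularity-Navie-d666958d-0 2026-08-15T10:52:28Z · rev 5 · ledger route-NavierStokesRegularity-DimensionLadder
GENERATED by the gate from the ledger (D-0016/17). Provers cite these decls: `theorem foo : Summit.NavierStokesRegularity.NavierStokesRegularity.Theses.DimensionLadder.<Decl> := …` in Summits/NavierStokesRegularity/NavierStokesRegularity/Theorems/<Name>.lean.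
-/

namespace Summit.NavierStokesRegularity.NavierStokesRegularity.Theses.DimensionLadder

open scoped BigOperators Topology Manifold Classical MeasureTheory ProbabilityTheory Matrix InnerProductSpace ComplexConjugate ContinuousMap
open Filter Set Function TopologicalSpace MeasureTheory

attribute [summit_statement] _root_.NavierStokesRegularity

open Literature.NS

/-- item stmt-NavierStokesRegularity-0725 · target · rank 0 · open · by planner
why it might fail: All risk is in X5a_axi (= AxisymBlowup): AxisymmetricSwirlRegularity (open, widely expected) + X5b gives not-X5a_axi (certifiedBlowup_kill_edge); axisymmetric NS blow-up has numerics only (Hou 2107.06509, 2405.10916). X5b is known: Tao2011 Cor 11.4 = fact tao_unconditional_uniqueness_velocity.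
sources: Literature.Analysis.FluidPDE.AxisymmetricSwirlRegularity, Literature.NS.certifiedBlowup_kill_edge, Literature.Analysis.FluidPDE.tao_unconditional_uniqueness_velocity (Tao2011 = arXiv:1108.1165 Cor. 11.4), Hou2022PotentiallySingularNS = arXiv:2107.06509, Hou2026 = arXiv:2405.10916, Fefferman2000 (Clay classes (A)/(C))
Re-framed thesis (supersedes informal stmt-NavierStokesRegularity-0268, whose (∃ d, Conditions d) ∧
X5b did not feed the assembly — refuter g3-0): X := X5a_axi ∧ X5b. X5a_axi = finite-time blow-up of
the Leray–Hopf classical solution from some rapidly decaying AXISYMMETRIC datum (Hou's interior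
tornado scenario arXiv:2107.06509, the target of the certified computation); X5b = Clay-class
uniqueness, verbatim stmt-NavierStokesRegularity-0153. The certificate (∃ d :
Literature.NS.BlowupProfileData, Literature.NS.BlowupProfileConditions d, stmt-…-0270) and the
analytic implication (0269, to be typed '(∃ d, Conditions d) → X5a_axi' once def wi-03627 lands) are
the METHOD for X5a_axi, kept as cruxes #3/#4. Kill:
Literature.Analysis.FluidPDE.AxisymmetricSwirlRegularity together with X5b refutes X. [sources:
arXiv:2107.06509, ChenHou2022, KNSS2009, Fefferman2000] -/
@[route_item "route-NavierStokesRegularity-DimensionLadder"]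
def Target : Prop :=
  (∃ ν : ℝ, 0 < ν ∧ ∃ T : ℝ, 0 < T ∧ ∃ (u : ℝ → EuclideanSpace ℝ (Fin 3) → EuclideanSpace ℝ (Fin 3)) (p : ℝ → EuclideanSpace ℝ (Fin 3) → ℝ), Literature.Analysis.FluidPDE.IsMaximalSmoothSolution ν 0 u p T ∧ Literature.Analysis.FluidPDE.IsLerayHopfOn T ν 0 (u 0) u ∧ Literature.Analysis.FluidPDE.HasRapidSpatialDecay (u 0) ∧ Literature.Analysis.FluidPDE.IsAxisymmetric (u 0)) ∧ (∀ ν : ℝ, 0 < ν → ∀ (u₀ : EuclideanSpace ℝ (Fin 3) → EuclideanSpace ℝ (Fin 3)), Literature.Analysis.FluidPDE.HasRapidSpatialDecay u₀ → ∀ (u v : ℝ → EuclideanSpace ℝ (Fin 3) → EuclideanSpace ℝ (Fin 3)) (p q : ℝ → EuclideanSpace ℝ (Fin 3) → ℝ) (T : ℝ), 0 < T → Literature.Analysis.FluidPDE.IsSmoothOnHalfSpace u → Literature.Analysis.FluidPDE.IsSmoothOnHalfSpace p → Literature.Analysis.FluidPDE.IsNavierStokesSolution ν 0 u₀ u p →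 Literature.Analysis.FluidPDE.HasBoundedEnergy u → Literature.Analysis.FluidPDE.IsClassicalNSSolutionOn (Set.Ico 0 T) ν 0 v q → Literature.Analysis.FluidPDE.IsLerayHopfOn T ν 0 u₀ v → v 0 = u₀ → ∀ t ∈ Set.Ico 0 T, u t = v t)

/-- item stmt-NavierStokesRegularity-1153 · crux · rank 2 · open · by planner
why it might fail: NS may be regular in EVERY d: no blow-up theorem for genuine NS in any dimension (only averaged/cheap/complex/dyadic models); the intended U(m)-Hopf-swirl class may be as tame as the swirl-free one (smooth swirl-free Euler data regular, 3<=d<=6, ShaoWeiZhang2026; numerics need C^a data, a<1-2/d).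
sources: Hou2026 = arXiv:2405.10916 (p.3: generalized n-dim axisymmetric NS; numerics only), Miller2025InfiniteDimVorticity = arXiv:2508.03877 (p.4 L86-87: Hou-Zhang C^{1,a} swirl-free numerics, a<1-2/d), MillerTsai2026 = arXiv:2204.13406 (pp.3-4: swirl-free d>=4, omega/r^{d-2} transported; only conditional criteria), ShaoWeiZhang2026 = doi:10.1007/s10114-026-5110-0 (swirl-free global regularity, 3<=d<=6; full text acq-02069), LemarieRieusset2016 §20.3 pp.768-771 (no blow-up known for NS; only model blow-ups), Tao2016AveragedNS; Literature.Barriers.NavierStokesRegularity.TaoAveragedBlowup / CheapNavierStokesBlowup / ComplexNavierStokesBlowup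
[crux] FIRST RUNG OF THE LADDER: the incompressible Navier–Stokes equations blow up in SOME space
dimension d ≥ 4 — there are ν > 0, T < ∞ and a classical solution (u,p) on ℝ^d × [0,T), Leray–Hopf
(finite energy) on [0,T), with smooth rapidly decaying datum u(0), admitting no classical extension
past T (all predicates are the tree's dimension-generic ones: IsMaximalSmoothSolution,
IsLerayHopfOn, HasRapidSpatialDecay over EuclideanSpace ℝ (Fin d)). Open in every d ≥ 3; d ≥ 4 is
asked so that the item is not a mere consequence of X5a. Intended construction class: odd d = 2m+1,
U(m)-equivariant data u₀ = u^r ζ/|ζ| + u^θ Jζ/|ζ| + u^z e_z on ℂ^m × ℝ (swirl along the Hopf field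
Jζ), for which NS reduces EXACTLY to Hou's generalized n-dimensional axisymmetric system with n = d
(planner's derivation, route NOTES F1; support HopfSwirlDictionary to be filed) — so Hou-type
dynamic-rescaling numerics at integer n ≥ 5 are numerics for this item. Heuristics for: energy
(d−2)/2 derivatives supercritical, no partial regularity for d ≥ 5, finite-energy self-similar
exponent window (2/(d+2), 1/2) widens with d. Why it might fail: NS may be regular in every
dimension; in particular swirl-free axisymm -/
@[route_item "route-NavierStokesRegularity-DimensionLadder"]
def HighDimBlowup : Prop :=
  ∃ d : ℕ, 4 ≤ d ∧ ∃ ν : ℝ, 0 < ν ∧ ∃ T : ℝ, 0 < T ∧ ∃ (u : ℝ → EuclideanSpace ℝ (Fin d) → EuclideanSpace ℝ (Fin d)) (p : ℝ → EuclideanSpace ℝ (Fin d) → ℝ), Literature.Analysis.FluidPDE.IsMaximalSmoothSolution ν 0 u p T ∧ Literature.Analysis.FluidPDE.IsLerayHopfOn T ν 0 (u 0) u ∧ Literature.Analysis.FluidPDE.HasRapidSpatialDecay (u 0)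

-- item stmt-NavierStokesRegularity-1212 · crux · rank 3 · open · by planner — informal only, no Lean statement yet:
--   [crux] LadderNoFold (rank 3; informal until the definition
--   Literature.Analysis.FluidPDE.GeneralizedAxisymNS lands — definition request filed): for EVERY real n
--   ≥ 3 there are ν > 0, T < ∞ and a solution (Γ, ω₁, ψ₁) of Hou's constant-viscosity generalized
--   n-dimensional axisymmetric Navier–Stokes system (arXiv:2405.10916 §1 eqs (1.1)–(1.3): Γ_t + u·∇Γ =
--   ν(Γ_rr + ((n−4)/r)Γ_r + ((6−2n)/r²)Γ + Γ_zz); ω₁,t + u·∇ω₁ = (Γ²/r⁴)_z − (n−3)ψ₁,z ω₁ + ν(ω₁,rr +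
--   (n/r)ω₁,r + ω₁,zz); −(∂_rr + (n/r)∂_r + ∂_zz)ψ₁ = ω₁; u^r = −rψ₁,z, u^z = (n−1)ψ₁ + rψ₁,r) that is
--   smooth and even in r on [0,T) × [0,∞) × ℝ, has fin

/-- item stmt-NavierStokesRegularity-0727 · crux · rank 4 · open · by planner
why it might fail: May be false: open wall AxisymmetricSwirlRegularity + X5b (known, Tao2011 Cor 11.4) gives not-X5a_axi (certifiedBlowup_kill_edge, proved). Type I excluded (KNSS2009 Thm 6.2), exact self-similarity too (NRS/Tsai): needs a Type II constant-nu witness on R^3; only cylinder numerics (Hou 2107.06509).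
sources: Literature.Analysis.FluidPDE.AxisymmetricSwirlRegularity (SelfSimilarLiouville.lean:547, open def), Literature.NS.certifiedBlowup_kill_edge (Theorems/CertifiedBlowupKillEdge.lean, proved), Literature.Analysis.FluidPDE.knss_no_axisymmetric_typeI; KochNadirashviliSereginSverak2009 = arXiv:0709.3599 Thms 6.1-6.2; SereginSverak2009; Seregin2024AxisymTypeII = arXiv:2402.13229, Literature.Barriers.NavierStokesRegularity.AxisymmetricTypeIExclusion; Literature.Barriers.NavierStokesRegularity.LeraySelfSimilarBlowupExclusion (NecasRuzickaSverak1996, Tsai1998), Hou2022PotentiallySingularNS = arXiv:2107.06509 (p.2 abstract, p.3: nu=5e-3, no-slip periodic cylinder - numerics only), ChenHou2022 = arXiv:2210.07191 Thm 2 (Euler analogue WITH boundary); Hou2026 = arXiv:2405.10916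
X5a_axi: ∃ ν>0, T∈(0,∞) and a classical NS solution (u,p) on ℝ³×[0,T), Leray–Hopf on [0,T), with
u(0) rapidly decaying AND axisymmetric (Literature.Analysis.FluidPDE.IsAxisymmetric), admitting no
classical extension past T. Strictly stronger than X5a (stmt-NavierStokesRegularity-0152, route
Blowup); isolates the scenario the certified computation targets: Hou's axisymmetric interior nearly
self-similar candidate (arXiv:2107.06509; NB Hou's NS numerics use a degenerate variable viscosity —
constant ν is the claim here), Euler analogue with boundary is a theorem
(Literature.Analysis.FluidPDE.chen_hou_blowup, ChenHou2022). Constraints any construction must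
respect: no-swirl data are globally regular
(Literature.Analysis.FluidPDE.axisymmetric_no_swirl_global_regularity) so swirl is essential;
axisymmetric Type I blow-up is excluded (Literature.Analysis.FluidPDE.knss_no_axisymmetric_typeI,
KNSS2009; Seregin–Šverák 2009) so the rate must be Type II; exactly self-similar finite-local-energy
profiles excluded (necas_ruzicka_sverak, tsai_selfsimilar). Negation follows from the wall
Literature.Analysis.FluidPDE.AxisymmetricSwirlRegularity given X5b. [sources: arXiv:2107.06509,
ChenHou2022, K -/
@[route_item "route-NavierStokesRegularity-DimensionLadder", crux]
def AxisymBlowup : Prop :=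
  ∃ ν : ℝ, 0 < ν ∧ ∃ T : ℝ, 0 < T ∧ ∃ (u : ℝ → EuclideanSpace ℝ (Fin 3) → EuclideanSpace ℝ (Fin 3)) (p : ℝ → EuclideanSpace ℝ (Fin 3) → ℝ), Literature.Analysis.FluidPDE.IsMaximalSmoothSolution ν 0 u p T ∧ Literature.Analysis.FluidPDE.IsLerayHopfOn T ν 0 (u 0) u ∧ Literature.Analysis.FluidPDE.HasRapidSpatialDecay (u 0) ∧ Literature.Analysis.FluidPDE.IsAxisymmetric (u 0)

/-- item stmt-NavierStokesRegularity-0153 · support · rank 9 · closed · proved by Summit.NavierStokesRegularity.NavierStokesRegularity.Theorems.adiabaticEddy_clayUniqueness_proof @ bd26efe366a2 (prover) · by planner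
sources: Tao2011 = arXiv:1108.1165 Cor. 11.4 + Remark 11.3 (Lemma 8.1, Cor. 11.1, Cor. 4.3, Thm 5.4(iii)), Literature.Analysis.FluidPDE.tao_unconditional_uniqueness_velocity (NSUnconditionalUniqueness.lean:66)
Fefferman's class (A) = jointly C^∞ on ℝ³×[0,∞) + sup_t ∫|u|² < ∞; no energy inequality, no decay of
∇u, no integrability in LPS scales is assumed. Claim: such (u,p) coincides on [0,T) with any
Leray–Hopf classical solution v from the same rapidly decaying datum. Expected route: smoothness +
bounded energy ⇒ u is a distributional solution with locally finite dissipation?? (NOT automatic: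
∫∫|∇u|² may be infinite) — this is exactly the delicate point; alternatives: Liouville-type control
of the pressure (p harmonic part must be affine ⇒ excluded by bounded energy), then local energy
inequality, then weak–strong uniqueness (Prodi 1959, Serrin 1963) against v which is in every LPS
class on compacts of [0,T). [sources: Prodi1959, Serrin1963, Fefferman2000, LemarieRieusset2002,
RobinsonRodrigoSadowski2016] -/
@[route_item "route-NavierStokesRegularity-DimensionLadder", crux]
def ClayUniqueness : Prop :=
  ∀ ν : ℝ, 0 < ν → ∀ (u₀ : EuclideanSpace ℝ (Fin 3) → EuclideanSpace ℝ (Fin 3)), Literature.Analysis.FluidPDE.HasRapidSpatialDecay u₀ → ∀ (u v : ℝ → EuclideanSpace ℝ (Fin 3) → EuclideanSpace ℝ (Fin 3)) (p q : ℝ → EuclideanSpace ℝ (Fin 3) → ℝ) (T : ℝ), 0 < T → Literature.Analysis.FluidPDE.IsSmoothOnHalfSpace u → Literature.Analysis.FluidPDE.IsSmoothOnHalfSpace p → Literature.Analysis.FluidPDE.IsNavierStokesSolution ν 0 u₀ u p → Literature.Analysis.FluidPDE.HasBoundedEnergy u → Literature.Analysis.FluidPDE.IsClassicalNSSolutionOn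 (Set.Ico 0 T) ν 0 v q → Literature.Analysis.FluidPDE.IsLerayHopfOn T ν 0 u₀ v → v 0 = u₀ → ∀ t ∈ Set.Ico 0 T, u t = v t

/-- `ClayUniqueness` holds: proved by `Summit.NavierStokesRegularity.NavierStokesRegularity.Theorems.adiabaticEddy_clayUniqueness_proof` @ bd26efe366a2. -/
theorem ClayUniqueness_holds : ClayUniqueness := _root_.Summit.NavierStokesRegularity.NavierStokesRegularity.Theorems.adiabaticEddy_clayUniqueness_proof

-- item stmt-NavierStokesRegularity-1251 · support · rank 9 · open · by planner — informal only, no Lean statement yet: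
--   [support] HopfSwirlDictionary (informal until Literature.Analysis.FluidPDE.GeneralizedAxisymNS
--   lands): for every m ≥ 1 and n = 2m+1, smooth even-in-r solutions (Γ, ω₁, ψ₁) of Hou's constant-ν
--   generalized n-dimensional axisymmetric NS system on a time set S correspond EXACTLY (both
--   directions, with finite weighted energy ↔ finite energy and maximality ↔ maximality, i.e.
--   IsMaximalSmoothSolution / IsLerayHopfOn / HasRapidSpatialDecay on EuclideanSpace ℝ (Fin (2m+1))) to
--   classical incompressible Navier–Stokes solutions (u, p) on ℝ^{2m+1} ≅ ℂ^m × ℝ that are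
--   U(m)-EQUIVARIANT, via u(ζ, z) = u^r(r,z)

/-- item stmt-NavierStokesRegularity-1154 · assembly · rank 1 · closed · proved by Summit.NavierStokesRegularity.NavierStokesRegularity.Theorems.swirlThreshold_assembly_proof (prover) · by planner
[assembly] X5a_axi → X5b → ¬NavierStokesRegularity: the curried form of CertifiedBlowup's Assembly2
(stmt-NavierStokesRegularity-0726, proved by Literature.NS.certifiedBlowup_assembly_v2); one line:
fun h₁ h₂ => certifiedBlowup_assembly_v2 ⟨h₁, h₂⟩ (checked in the planner's Sketch.lean). The
ladder-specific logic (LadderNoFold at n = 3 + HopfSwirlDictionary at m = 1 ⇒ AxisymBlowup; at n = 5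
⇒ HighDimBlowup) becomes glue items once Literature.Analysis.FluidPDE.GeneralizedAxisymNS is
defined. [sources: Fefferman2000] -/
@[route_item "route-NavierStokesRegularity-DimensionLadder"]
def Assembly : Prop :=
  (∃ ν : ℝ, 0 < ν ∧ ∃ T : ℝ, 0 < T ∧ ∃ (u : ℝ → EuclideanSpace ℝ (Fin 3) → EuclideanSpace ℝ (Fin 3)) (p : ℝ → EuclideanSpace ℝ (Fin 3) → ℝ), Literature.Analysis.FluidPDE.IsMaximalSmoothSolution ν 0 u p T ∧ Literature.Analysis.FluidPDE.IsLerayHopfOn T ν 0 (u 0) u ∧ Literature.Analysis.FluidPDE.HasRapidSpatialDecay (u 0) ∧ Literature.Analysis.FluidPDE.IsAxisymmetric (u 0)) → (∀ ν : ℝ, 0 < ν → ∀ (u₀ : EuclideanSpace ℝ (Fin 3) → EuclideanSpace ℝ (Fin 3)), Literature.Analysis.FluidPDE.HasRapidSpatialDecay u₀ → ∀ (u v : ℝ → EuclideanSpace ℝ (Fin 3) → EuclideanSpace ℝ (Fin 3)) (p q : ℝ → EuclideanSpace ℝ (Fin 3) → ℝ) (T : ℝ), 0 < T → Literature.Analysis.FluidPDE.IsSmoothOnHalfSpace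 u → Literature.Analysis.FluidPDE.IsSmoothOnHalfSpace p → Literature.Analysis.FluidPDE.IsNavierStokesSolution ν 0 u₀ u p → Literature.Analysis.FluidPDE.HasBoundedEnergy u → Literature.Analysis.FluidPDE.IsClassicalNSSolutionOn (Set.Ico 0 T) ν 0 v q → Literature.Analysis.FluidPDE.IsLerayHopfOn T ν 0 u₀ v → v 0 = u₀ → ∀ t ∈ Set.Ico 0 T, u t = v t) → ¬ NavierStokesRegularity

/-- `Assembly` holds: proved by `Summit.NavierStokesRegularity.NavierStokesRegularity.Theorems.swirlThreshold_assembly_proof`. -/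
theorem Assembly_holds : Assembly := _root_.Summit.NavierStokesRegularity.NavierStokesRegularity.Theorems.swirlThreshold_assembly_proof

/-! D-0027 §2.1 — DECIDING THEOREM (planner-authored via `route open/edit --closes-file`; by planner-rbadge-NavierStokesRegularity-Dimensio-0bc81f18-g2-0 2026-08-15T16:11:36Z):
its hypotheses are this route's items and its conclusion the sub-problem Statement (glue_lint), and it elaborates with this file. -/

/-- DECIDING THEOREM (D-0027 §2.1; refutation side): the two n = 3 endpoint items of the ladder —
`AxisymBlowup` (= X5a_axi, stmt-NavierStokesRegularity-0727: finite-time blow-up of a maximal smooth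
Leray–Hopf solution from a rapidly decaying axisymmetric datum) and `ClayUniqueness` (= X5b,
stmt-NavierStokesRegularity-0153: Clay-class uniqueness) — refute Clay statement (A)
`NavierStokesRegularity`. Pure logic, self-contained in this file's imports (the argument of
`Literature.NS.blowup_assembly` / `certifiedBlowup_assembly_v2` with the wave-0 bridge inlined):
(A) applied to the datum `u 0` gives a global smooth bounded-energy solution `(u', p')`;
`ClayUniqueness` glues it to `u` on `[0, T)`; `(u', p')` is a classical solution on `Ici 0`, and its
restriction to `Ico 0 (T + 1)` is a smooth extension of `u` past `T`, contradicting maximality.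
The method cruxes `HighDimBlowup`, `LadderNoFold` and the support `HopfSwirlDictionary` are how
`AxisymBlowup` is to be reached (ladder in the dimension), not hypotheses of the decision. -/
@[closes "route-NavierStokesRegularity-DimensionLadder"] theorem closes (hA : AxisymBlowup) (hU : ClayUniqueness) : ¬ NavierStokesRegularity := by
  intro hReg
  obtain ⟨ν, hν, T, hT, u, p, ⟨hcl, hmax⟩, hLH, hdec, -⟩ := hA
  have h0 : (0 : ℝ) ∈ Set.Ico 0 T := ⟨le_rfl, hT⟩
  obtain ⟨u', p', hu', hp', hns, hbe⟩ :=
    hReg ν hν (u 0) (hcl.contDiff_velocity h0) (hcl.divFree 0 h0) hdec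
  have heq : ∀ t ∈ Set.Ico 0 T, u' t = u t :=
    hU ν hν (u 0) hdec u' u p' p T hT hu' hp' hns hbe hcl hLH rfl
  have hcl' : Literature.Analysis.FluidPDE.IsClassicalNSSolutionOn (Set.Ici 0) ν 0 u' p' :=
    ⟨hu', hp', fun t ht x => hns.momentum t ht x, fun t ht => hns.divFree t ht⟩
  refine hmax ⟨T + 1, by linarith, u', p', ?_, heq⟩
  exact hcl'.mono (fun t ht => ht.1) (uniqueDiffOn_Ico 0 (T + 1))

end Summit.NavierStokesRegularity.NavierStokesRegularity.Theses.DimensionLadder
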